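import Mathlib
import Literature.NumberTheory.LFunctions.Zhang2022.Section16Lemma162RPerturb
import HarnessLib

/-!
# Zhang (2022) §16 Lemma 16.2 at the repaired normaliser (GAP row G-d57-1), part 6: the Euler factor of
# `E₂ⱼ` at `s = 1` against its `β → 0` model, and the model's closed form

Topic `Literature/NumberTheory/LFunctions/Zhang2022` (Landau–Siegel audit tree; verdict-neutral).
Y. Zhang, *Discrete mean estimates and the Landau–Siegel zero*, arXiv:2211.02515v1 (2022)
[Zhang2022LandauSiegel] — **an unrefereed manuscript under adjudication; nothing here asserts or denies
its Theorems 1–2.** ZHANG-L WP16 block D, sub-leaf `Typed.Section16B.Lemma162R`, clause (iv) (Lemma 16.2,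
§16 p. 94; App. A p. 106). Theorems only; no definitions, no facts.

For an odd prime `q` (or `q = 2` with `χ(2) ≠ 1`) with `χ(q) = v ∈ {±1}` the Euler factor of `E₂ⱼ` at `s = 1`
is `Φ_q(1) = N_q(q⁻¹)·Σ_e c_e q^{−e}` (parts 2–4). With the model coefficients `c⁰_e` of part 5:
* `‖Σ_e c_e q^{−e} − Σ_e c⁰_e q^{−e}‖ ≤ 1.4·10⁹ δ_q/q`, `‖N_q(q⁻¹) − N⁰_q(q⁻¹)‖ ≤ 25 δ_q/q`, hence
  `‖Φ_q(1) − Φ⁰_q‖ ≤ 2.5·10¹⁰·δ_q/q` (`norm_Phi_one_sub_model_le`);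
* **the model in closed form**: `Σ_e (ν∗χ)(q^e) zᵉ = ((1−z)(1−vz)²)⁻¹` (two Cauchy products), and
  `Φ⁰_q = N⁰_q(q⁻¹)Σ_e c⁰_e q^{−e} = (1 − q⁻²)(1 − v/q)/(1 − v/(q−1))` for `v = 1` (`q ≥ 3`) and `v = −1`
  (`Phi_model_eq`) — the local factor of `(6/π²)·𝔭⁻¹` in Lemma 16.2's main term.

## References

* Y. Zhang, arXiv:2211.02515v1 (2022), §16 Lemma 16.2 p. 94; App. A pp. 105–106.
  [cite: Zhang2022LandauSiegel, §16 Lemma 16.2 p.94]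
-/

noncomputable section

open Complex Real Finset Filter Topology

namespace Literature.NumberTheory.LFunctions.Zhang2022.Lemma162R

open Literature.NumberTheory.LFunctions.Zhang2022
open Literature.NumberTheory.LFunctions.Zhang2022.Skeleton
open Literature.NumberTheory.LFunctions.Zhang2022.Typed.Section16A
open Literature.NumberTheory.LFunctions.Zhang2022.Typed.Section16B
open Literature.NumberTheory.LFunctions.Zhang2022.AppendixA

/-! ## §1. Series with quartic coefficient growth at `r ≤ 1/2` -/

section Series

/-- `(e+1)(e+2)(e+3) = 6·C(e+3,3)`. [folklore] -/
private theorem choose_three_mul_six' (e : ℕ) : 6 * (e + 3).choose 3 = (e + 1) * (e + 2) * (e + 3) := by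
  have h := Nat.choose_mul_factorial_mul_factorial (show 3 ≤ e + 3 by omega)
  rw [show e + 3 - 3 = e from by omega] at h
  have h3 : (3 : ℕ).factorial = 6 := by decide
  have hf : (e + 3).factorial = (e + 1) * (e + 2) * (e + 3) * e.factorial := by
    rw [show e + 3 = (e + 2) + 1 from rfl, Nat.factorial_succ, show e + 2 = (e + 1) + 1 from rfl,
      Nat.factorial_succ, Nat.factorial_succ]; ring
  rw [h3, hf] at h
  have he : 0 < e.factorial := Nat.factorial_pos e
  apply Nat.eq_of_mul_eq_mul_right he
  calc 6 * (e + 3).choose 3 * e.factorial = (e + 3).choose 3 * 6 * e.factorial := by ring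
    _ = (e + 1) * (e + 2) * (e + 3) * e.factorial := h

/-- `(e+1)³ ≤ 6·C(e+3,3)` and `(e+3)³ ≤ 27·C(e+3,3)` (as reals). [folklore] -/
private theorem cube_le_choose' (e : ℕ) :
    ((e : ℝ) + 1) ^ 3 ≤ 6 * ((e + 3).choose 3 : ℝ) ∧ ((e : ℝ) + 3) ^ 3 ≤ 27 * ((e + 3).choose 3 : ℝ) := by
  have h : (6 : ℝ) * ((e + 3).choose 3 : ℝ) = ((e : ℝ) + 1) * ((e : ℝ) + 2) * ((e : ℝ) + 3) := by
    exact_mod_cast choose_three_mul_six' e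
  have he : (0 : ℝ) ≤ e := Nat.cast_nonneg e
  constructor
  · rw [h]; nlinarith [mul_nonneg he he, mul_nonneg (mul_nonneg he he) he]
  · rw [show (27 : ℝ) * ((e + 3).choose 3 : ℝ) = 9 / 2 * (6 * ((e + 3).choose 3 : ℝ)) by ring, h]
    nlinarith [mul_nonneg he he, mul_nonneg (mul_nonneg he he) he]

/-- For `0 ≤ r < 1`: `Σ_e C(e+3,3) rᵉ = (1−r)⁻⁴` is summable with that value. [folklore] -/
private theorem hasSum_choose_three' {r : ℝ} (hr0 : 0 ≤ r) (hr : r < 1) :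
    HasSum (fun e : ℕ => ((e + 3).choose 3 : ℝ) * r ^ e) (1 / (1 - r) ^ 4) := by
  have h := hasSum_choose_mul_geometric_of_norm_lt_one 3 (r := r) (by rw [Real.norm_eq_abs, abs_of_nonneg hr0]; exact hr)
  simpa using h

/-- **Summability**: `|c_e| ≤ M(e+1)³`, `‖y‖ < 1` ⇒ `Σ c_e yᵉ` converges absolutely. [folklore] -/
private theorem summable_norm_coeff_mul_pow' {c : ℕ → ℂ} {M : ℝ} (hc : ∀ e, ‖c e‖ ≤ M * ((e : ℝ) + 1) ^ 3)
    {y : ℂ} (hy : ‖y‖ < 1) : Summable fun e : ℕ => ‖c e * y ^ e‖ := by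
  have hM : 0 ≤ M := by have := hc 0; simp at this; linarith [norm_nonneg (c 0)]
  have hs := ((hasSum_choose_three' (norm_nonneg y) hy).summable.mul_left (6 * M))
  refine Summable.of_nonneg_of_le (fun _ => norm_nonneg _) (fun e => ?_) hs
  rw [norm_mul, norm_pow]
  have h1 := (cube_le_choose' e).1
  calc ‖c e‖ * ‖y‖ ^ e ≤ (M * ((e : ℝ) + 1) ^ 3) * ‖y‖ ^ e := by gcongr; exact hc e
    _ ≤ (M * (6 * ((e + 3).choose 3 : ℝ))) * ‖y‖ ^ e := by gcongr
    _ = 6 * M * (((e + 3).choose 3 : ℝ) * ‖y‖ ^ e) := by ring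

/-- Termwise majorant: `‖c_e yᵉ‖ ≤ 6M·C(e+3,3)‖y‖ᵉ`. [folklore] -/
private theorem norm_coeff_mul_pow_le' {c : ℕ → ℂ} {M : ℝ} (hc : ∀ e, ‖c e‖ ≤ M * ((e : ℝ) + 1) ^ 3)
    (y : ℂ) (e : ℕ) : ‖c e * y ^ e‖ ≤ 6 * M * (((e + 3).choose 3 : ℝ) * ‖y‖ ^ e) := by
  have hM : 0 ≤ M := by have := hc 0; simp at this; linarith [norm_nonneg (c 0)]
  rw [norm_mul, norm_pow]
  have h1 := (cube_le_choose' e).1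
  have h2 : ‖c e‖ ≤ M * (6 * ((e + 3).choose 3 : ℝ)) := (hc e).trans (by gcongr)
  have h3 : 0 ≤ ‖y‖ ^ e := pow_nonneg (norm_nonneg _) e
  calc ‖c e‖ * ‖y‖ ^ e ≤ (M * (6 * ((e + 3).choose 3 : ℝ))) * ‖y‖ ^ e := mul_le_mul_of_nonneg_right h2 h3
    _ = 6 * M * (((e + 3).choose 3 : ℝ) * ‖y‖ ^ e) := by ring

/-- `1/(1−r)⁴ ≤ 40` for `0 ≤ r ≤ 3/5`. [folklore] -/
private theorem one_div_pow_four_le' {r : ℝ} (hr : r ≤ 3 / 5) : 1 / (1 - r) ^ 4 ≤ 40 := by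
  have h25 : (2 / 5 : ℝ) ≤ 1 - r := by linarith
  have hpow : (2 / 5 : ℝ) ^ 4 ≤ (1 - r) ^ 4 := pow_le_pow_left₀ (by norm_num) h25 4
  rw [div_le_iff₀ (lt_of_lt_of_le (by norm_num) hpow)]
  nlinarith

/-- **Size**: `|c_e| ≤ M(e+1)³`, `‖y‖ ≤ 3/5` ⇒ `‖Σ c_e yᵉ‖ ≤ 240M` (`6M/(1−‖y‖)⁴ ≤ 240M`). [folklore] -/
private theorem norm_tsum_coeff_mul_pow_le' {c : ℕ → ℂ} {M : ℝ} (hc : ∀ e, ‖c e‖ ≤ M * ((e : ℝ) + 1) ^ 3)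
    {y : ℂ} (hy : ‖y‖ ≤ 3 / 5) : ‖∑' e : ℕ, c e * y ^ e‖ ≤ 240 * M := by
  have hM : 0 ≤ M := by have := hc 0; simp at this; linarith [norm_nonneg (c 0)]
  have hy1 : ‖y‖ < 1 := by linarith
  have hS := hasSum_choose_three' (norm_nonneg y) hy1
  have hsum := summable_norm_coeff_mul_pow' hc hy1
  have hmaj : Summable fun e : ℕ => 6 * M * (((e + 3).choose 3 : ℝ) * ‖y‖ ^ e) := hS.summable.mul_left _
  have h1 : ‖∑' e : ℕ, c e * y ^ e‖ ≤ ∑' e : ℕ, ‖c e * y ^ e‖ := norm_tsum_le_tsum_norm hsum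
  have h2 : ∑' e : ℕ, ‖c e * y ^ e‖ ≤ ∑' e : ℕ, 6 * M * (((e + 3).choose 3 : ℝ) * ‖y‖ ^ e) :=
    Summable.tsum_le_tsum (fun e => norm_coeff_mul_pow_le' hc y e) hsum hmaj
  have h3 : ∑' e : ℕ, 6 * M * (((e + 3).choose 3 : ℝ) * ‖y‖ ^ e) = 6 * M * (1 / (1 - ‖y‖) ^ 4) := by
    rw [tsum_mul_left, hS.tsum_eq]
  have h4 := one_div_pow_four_le' hy
  have h5 : 6 * M * (1 / (1 - ‖y‖) ^ 4) ≤ 6 * M * 40 := mul_le_mul_of_nonneg_left h4 (by positivity)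
  have h6 : ‖∑' e : ℕ, c e * y ^ e‖ ≤ 6 * M * 40 := (h1.trans h2).trans (h3.le.trans h5)
  have h7 : (6 : ℝ) * M * 40 = 240 * M := by ring
  rw [h7] at h6
  exact h6

/-- `(e+1)(e+2)(e+3)(e+4) = 24·C(e+4,4)`. [folklore] -/
private theorem choose_four_mul (e : ℕ) : 24 * (e + 4).choose 4 = (e + 1) * (e + 2) * (e + 3) * (e + 4) := by
  have h := Nat.choose_mul_factorial_mul_factorial (show 4 ≤ e + 4 by omega)
  rw [show e + 4 - 4 = e from by omega] at h
  have h4 : (4 : ℕ).factorial = 24 := by decide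
  have hf : (e + 4).factorial = (e + 1) * (e + 2) * (e + 3) * (e + 4) * e.factorial := by
    rw [show e + 4 = (e + 3) + 1 from rfl, Nat.factorial_succ, show e + 3 = (e + 2) + 1 from rfl,
      Nat.factorial_succ, show e + 2 = (e + 1) + 1 from rfl, Nat.factorial_succ, Nat.factorial_succ]; ring
  rw [h4, hf] at h
  have he : 0 < e.factorial := Nat.factorial_pos e
  apply Nat.eq_of_mul_eq_mul_right he
  calc 24 * (e + 4).choose 4 * e.factorial = (e + 4).choose 4 * 24 * e.factorial := by ring
    _ = (e + 1) * (e + 2) * (e + 3) * (e + 4) * e.factorial := h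

/-- `(e+2)⁴ ≤ 16·24·C(e+4,4)` (as reals). [folklore] -/
private theorem quartic_le_choose (e : ℕ) : ((e : ℝ) + 2) ^ 4 ≤ 384 * ((e + 4).choose 4 : ℝ) := by
  have h : (24 : ℝ) * ((e + 4).choose 4 : ℝ) = ((e : ℝ) + 1) * ((e : ℝ) + 2) * ((e : ℝ) + 3) * ((e : ℝ) + 4) := by
    exact_mod_cast choose_four_mul e
  have he : (0 : ℝ) ≤ e := Nat.cast_nonneg e
  rw [show (384 : ℝ) * ((e + 4).choose 4 : ℝ) = 16 * (24 * ((e + 4).choose 4 : ℝ)) by ring, h]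
  nlinarith [mul_nonneg he he, mul_nonneg (mul_nonneg he he) he, mul_nonneg (mul_nonneg (mul_nonneg he he) he) he,
    pow_nonneg he 4]

/-- `Σ_e (e+2)⁴ 2^{−e} ≤ 12288`. [folklore] -/
private theorem tsum_quartic_half_le :
    Summable (fun e : ℕ => ((e : ℝ) + 2) ^ 4 * (1 / 2 : ℝ) ^ e) ∧
      ∑' e : ℕ, ((e : ℝ) + 2) ^ 4 * (1 / 2 : ℝ) ^ e ≤ 12288 := by
  have hS := hasSum_choose_mul_geometric_of_norm_lt_one 4 (r := (1 / 2 : ℝ)) (by norm_num)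
  have hS' : HasSum (fun e : ℕ => ((e + 4).choose 4 : ℝ) * (1 / 2 : ℝ) ^ e) 32 := by
    have h32 : (1 : ℝ) / (1 - 1 / 2) ^ (4 + 1) = 32 := by norm_num
    rw [← h32]; exact hS
  have hmaj : Summable fun e : ℕ => 384 * (((e + 4).choose 4 : ℝ) * (1 / 2 : ℝ) ^ e) := hS'.summable.mul_left _
  have hle : ∀ e : ℕ, ((e : ℝ) + 2) ^ 4 * (1 / 2 : ℝ) ^ e ≤ 384 * (((e + 4).choose 4 : ℝ) * (1 / 2 : ℝ) ^ e) := by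
    intro e
    rw [← mul_assoc]
    exact mul_le_mul_of_nonneg_right (quartic_le_choose e) (by positivity)
  have hsum : Summable (fun e : ℕ => ((e : ℝ) + 2) ^ 4 * (1 / 2 : ℝ) ^ e) :=
    Summable.of_nonneg_of_le (fun e => by positivity) hle hmaj
  refine ⟨hsum, ?_⟩
  calc _ ≤ ∑' e : ℕ, 384 * (((e + 4).choose 4 : ℝ) * (1 / 2 : ℝ) ^ e) := Summable.tsum_le_tsum hle hsum hmaj
    _ = 384 * 32 := by rw [tsum_mul_left, hS'.tsum_eq]
    _ = 12288 := by norm_num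

/-- **Series comparison at `‖y‖ = 1/q ≤ 1/2`**: if `d 0 = 0` and `‖d e‖ ≤ K(e+1)⁴` then
`‖Σ_e d_e yᵉ‖ ≤ 12288·K·‖y‖` (the `e ≥ 1` tail; `(e+2)⁴(1/2)^e` summed). [folklore] -/
private theorem norm_tsum_diff_le {d : ℕ → ℂ} {K : ℝ} (hK : 0 ≤ K) (hd : ∀ e, ‖d e‖ ≤ K * ((e : ℝ) + 1) ^ 4)
    (hd0 : d 0 = 0) {y : ℂ} (hy : ‖y‖ ≤ 1 / 2) :
    (Summable fun e : ℕ => d e * y ^ e) ∧ ‖∑' e : ℕ, d e * y ^ e‖ ≤ 12288 * K * ‖y‖ := by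
  obtain ⟨hqs, hqle⟩ := tsum_quartic_half_le
  -- majorant for the shifted series
  have hmaj : Summable fun e : ℕ => K * ‖y‖ * (((e : ℝ) + 2) ^ 4 * (1 / 2 : ℝ) ^ e) := hqs.mul_left _
  have hle : ∀ e : ℕ, ‖d (e + 1) * y ^ (e + 1)‖ ≤ K * ‖y‖ * (((e : ℝ) + 2) ^ 4 * (1 / 2 : ℝ) ^ e) := by
    intro e
    rw [norm_mul, norm_pow, pow_succ]
    have h1 : ‖d (e + 1)‖ ≤ K * ((e : ℝ) + 2) ^ 4 := by
      have := hd (e + 1); push_cast at this; rw [show (e : ℝ) + 1 + 1 = e + 2 by ring] at this; exact this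
    have h2 : ‖y‖ ^ e ≤ (1 / 2 : ℝ) ^ e := pow_le_pow_left₀ (norm_nonneg _) hy e
    calc ‖d (e + 1)‖ * (‖y‖ ^ e * ‖y‖) ≤ (K * ((e : ℝ) + 2) ^ 4) * ((1 / 2 : ℝ) ^ e * ‖y‖) := by
          gcongr
      _ = K * ‖y‖ * (((e : ℝ) + 2) ^ 4 * (1 / 2 : ℝ) ^ e) := by ring
  have hs1 : Summable fun e : ℕ => d (e + 1) * y ^ (e + 1) :=
    Summable.of_norm_bounded hmaj hle
  have hs : Summable fun e : ℕ => d e * y ^ e := (summable_nat_add_iff (f := fun e => d e * y ^ e) 1).mp hs1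
  refine ⟨hs, ?_⟩
  rw [hs.tsum_eq_zero_add, hd0, zero_mul, zero_add]
  calc ‖∑' e : ℕ, d (e + 1) * y ^ (e + 1)‖ ≤ ∑' e : ℕ, ‖d (e + 1) * y ^ (e + 1)‖ := norm_tsum_le_tsum_norm hs1.norm
    _ ≤ ∑' e : ℕ, K * ‖y‖ * (((e : ℝ) + 2) ^ 4 * (1 / 2 : ℝ) ^ e) := Summable.tsum_le_tsum hle hs1.norm hmaj
    _ = K * ‖y‖ * ∑' e : ℕ, ((e : ℝ) + 2) ^ 4 * (1 / 2 : ℝ) ^ e := tsum_mul_left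
    _ ≤ K * ‖y‖ * 12288 := by gcongr
    _ = 12288 * K * ‖y‖ := by ring

end Series

/-! ## §2. `Φ_q(1)` against the model `Φ⁰_q = N⁰_q(q⁻¹)·Σ_e c⁰_e q^{−e}` -/

section PhiModel

variable (c' : ℝ) {D : ℕ} [NeZero D] (χ : DirichletCharacter ℂ D) (j : ℕ)

omit [NeZero D] in
/-- **The normaliser polynomial at `w = q^{β_j}` against `w = 1`**: for `‖x‖ ≤ 1/2`, `‖w‖ = 1`, `‖v‖ ≤ 1`,
`‖(1−x)²(1−wx)(1−vx)(1−vwx)² − (1−x)²(1−x)(1−vx)(1−vx)²‖ ≤ 25‖w − 1‖‖x‖`.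
[cite: Zhang2022LandauSiegel, §16 Lemma 16.2 p.94] -/
theorem norm_normPoly_sub_model_le {x w v : ℂ} (hx : ‖x‖ ≤ 1 / 2) (hw : ‖w‖ = 1) (hv : ‖v‖ ≤ 1) :
    ‖(1 - x) ^ 2 * (1 - w * x) * (1 - v * x) * (1 - v * (w * x)) ^ 2 -
        (1 - x) ^ 2 * (1 - 1 * x) * (1 - v * x) * (1 - v * (1 * x)) ^ 2‖ ≤ 25 * ‖w - 1‖ * ‖x‖ := by
  have hb : ∀ z : ℂ, ‖z‖ ≤ 1 / 2 → ‖1 - z‖ ≤ 3 / 2 := fun z hz =>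
    (norm_sub_le _ _).trans (by rw [norm_one]; linarith)
  have hwx : ‖w * x‖ ≤ 1 / 2 := by rw [norm_mul, hw, one_mul]; exact hx
  have hvx : ‖v * x‖ ≤ 1 / 2 := by rw [norm_mul]; nlinarith [norm_nonneg v, norm_nonneg x]
  have hvwx : ‖v * (w * x)‖ ≤ 1 / 2 := by rw [norm_mul]; nlinarith [norm_nonneg v, norm_nonneg (w * x)]
  have hv1x : ‖v * (1 * x)‖ ≤ 1 / 2 := by rw [one_mul]; exact hvx
  -- the difference of the `w`-dependent part
  have hd1 : ‖(1 - w * x) - (1 - 1 * x)‖ ≤ ‖w - 1‖ * ‖x‖ := by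
    rw [show (1 - w * x) - (1 - 1 * x) = -((w - 1) * x) by ring, norm_neg, norm_mul]
  have hd2 : ‖(1 - v * (w * x)) ^ 2 - (1 - v * (1 * x)) ^ 2‖ ≤ 3 * (‖w - 1‖ * ‖x‖) := by
    rw [show (1 - v * (w * x)) ^ 2 - (1 - v * (1 * x)) ^ 2 =
      -(v * (w - 1) * x) * ((1 - v * (w * x)) + (1 - v * (1 * x))) by ring, norm_mul, norm_neg, norm_mul, norm_mul]
    have h3 : ‖(1 - v * (w * x)) + (1 - v * (1 * x))‖ ≤ 3 :=
      (norm_add_le _ _).trans (by linarith [hb _ hvwx, hb _ hv1x])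
    calc ‖v‖ * ‖w - 1‖ * ‖x‖ * ‖(1 - v * (w * x)) + (1 - v * (1 * x))‖ ≤ 1 * ‖w - 1‖ * ‖x‖ * 3 := by gcongr
      _ = 3 * (‖w - 1‖ * ‖x‖) := by ring
  -- `A·B·C² − A·B'·C'² = A[(B − B')C² + B'(C² − C'²)]`
  set A : ℂ := (1 - x) ^ 2 * (1 - v * x) with hA
  have hAn : ‖A‖ ≤ (3 / 2) ^ 2 * (3 / 2) := by
    rw [hA, norm_mul, norm_pow]
    gcongr
    · exact hb x hx
    · exact hb _ hvx
  rw [show (1 - x) ^ 2 * (1 - w * x) * (1 - v * x) * (1 - v * (w * x)) ^ 2 -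
        (1 - x) ^ 2 * (1 - 1 * x) * (1 - v * x) * (1 - v * (1 * x)) ^ 2 =
      A * (((1 - w * x) - (1 - 1 * x)) * (1 - v * (w * x)) ^ 2 + (1 - 1 * x) * ((1 - v * (w * x)) ^ 2 - (1 - v * (1 * x)) ^ 2))
      by rw [hA]; ring, norm_mul]
  have hC2 : ‖(1 - v * (w * x)) ^ 2‖ ≤ (3 / 2) ^ 2 := by rw [norm_pow]; gcongr; exact hb _ hvwx
  have hB' : ‖1 - 1 * x‖ ≤ 3 / 2 := by rw [one_mul]; exact hb x hx
  have hinner : ‖((1 - w * x) - (1 - 1 * x)) * (1 - v * (w * x)) ^ 2 +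
      (1 - 1 * x) * ((1 - v * (w * x)) ^ 2 - (1 - v * (1 * x)) ^ 2)‖ ≤
      (‖w - 1‖ * ‖x‖) * (3 / 2) ^ 2 + (3 / 2) * (3 * (‖w - 1‖ * ‖x‖)) := by
    calc _ ≤ ‖((1 - w * x) - (1 - 1 * x)) * (1 - v * (w * x)) ^ 2‖ +
          ‖(1 - 1 * x) * ((1 - v * (w * x)) ^ 2 - (1 - v * (1 * x)) ^ 2)‖ := norm_add_le _ _
      _ ≤ _ := by rw [norm_mul, norm_mul]; gcongr
  calc ‖A‖ * _ ≤ ((3 / 2) ^ 2 * (3 / 2)) * ((‖w - 1‖ * ‖x‖) * (3 / 2) ^ 2 + (3 / 2) * (3 * (‖w - 1‖ * ‖x‖))) :=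
        mul_le_mul hAn hinner (norm_nonneg _) (by positivity)
    _ ≤ 25 * ‖w - 1‖ * ‖x‖ := by nlinarith [mul_nonneg (norm_nonneg (w - 1)) (norm_nonneg x)]

/-- **`Φ_q(1)` against its model**: for a prime `q` with `χ(q) ∈ {0,±1}`, not (`q = 2 ∧ χ(2) = 1`), and
`‖F_q(1,1;1−β_j)‖ ≥ 1/2`,
`‖N_q(q⁻¹)·Σ_e c_e q^{−e} − N⁰_q(q⁻¹)·Σ_e c⁰_e q^{−e}‖ ≤ 2.5·10¹⁰·δ_q/q`
(`δ_q = ‖q^{−β₁} − 1‖ + ‖q^{β_j} − 1‖`; series comparison `norm_coeff_sub_model_le` summed at `q^{−1}`, plus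
`norm_normPoly_sub_model_le`). [cite: Zhang2022LandauSiegel, §16 Lemma 16.2 p.94, App. A p.106] -/
theorem norm_Phi_one_sub_model_le {q : ℕ} (hq : q.Prime)
    (hv : χ (q : ZMod D) = 0 ∨ χ (q : ZMod D) = 1 ∨ χ (q : ZMod D) = -1) (h2 : q = 2 → χ (2 : ZMod D) ≠ 1)
    (hF : 1 / 2 ≤ ‖calM2Factor c' χ q 1 1 (1 - betaJ c' D j)‖) :
    (Summable fun e : ℕ => (∑ i ∈ Finset.range (e + 1), χ (q : ZMod D) ^ (e - i) *
          ((1 - (if Nat.Coprime q (q ^ (e - i)) then (1 : ℂ) else 0) * (χ (q : ZMod D) / ((q : ℂ) - 1))) /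
            (1 - 1 * (χ (q : ZMod D) / ((q : ℂ) - 1))))) * nuConvChi χ (q ^ e) * ((q : ℂ) ^ (-(1 : ℂ))) ^ e) ∧
    ‖(1 - (q : ℂ) ^ (-(1 : ℂ))) ^ 2 * (1 - (q : ℂ) ^ betaJ c' D j * (q : ℂ) ^ (-(1 : ℂ))) *
          (1 - χ (q : ZMod D) * (q : ℂ) ^ (-(1 : ℂ))) *
            (1 - χ (q : ZMod D) * ((q : ℂ) ^ betaJ c' D j * (q : ℂ) ^ (-(1 : ℂ)))) ^ 2 *
        (∑' e : ℕ, varpi2loc c' χ j (q ^ e) * nuConvChi χ (q ^ e) * ((q : ℂ) ^ (-(1 : ℂ))) ^ e) -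
      (1 - (q : ℂ) ^ (-(1 : ℂ))) ^ 2 * (1 - 1 * (q : ℂ) ^ (-(1 : ℂ))) * (1 - χ (q : ZMod D) * (q : ℂ) ^ (-(1 : ℂ))) *
            (1 - χ (q : ZMod D) * (1 * (q : ℂ) ^ (-(1 : ℂ)))) ^ 2 *
        (∑' e : ℕ, (∑ i ∈ Finset.range (e + 1), χ (q : ZMod D) ^ (e - i) *
          ((1 - (if Nat.Coprime q (q ^ (e - i)) then (1 : ℂ) else 0) * (χ (q : ZMod D) / ((q : ℂ) - 1))) /
            (1 - 1 * (χ (q : ZMod D) / ((q : ℂ) - 1))))) * nuConvChi χ (q ^ e) * ((q : ℂ) ^ (-(1 : ℂ))) ^ e)‖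
      ≤ 25000000000 * (‖(q : ℂ) ^ (-beta1 c' D) - 1‖ + ‖(q : ℂ) ^ betaJ c' D j - 1‖) / q := by
  set v : ℂ := χ (q : ZMod D) with hvdef
  set δ : ℝ := ‖(q : ℂ) ^ (-beta1 c' D) - 1‖ + ‖(q : ℂ) ^ betaJ c' D j - 1‖ with hδ
  set y : ℂ := (q : ℂ) ^ (-(1 : ℂ)) with hydef
  set w : ℂ := (q : ℂ) ^ betaJ c' D j with hwdef
  have hδ0 : 0 ≤ δ := by positivity
  have hq2 : (2 : ℝ) ≤ q := by exact_mod_cast hq.two_le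
  have hq0 : (0 : ℝ) < q := by linarith
  have hyn : ‖y‖ = (q : ℝ)⁻¹ := by
    rw [hydef, Complex.norm_natCast_cpow_of_pos hq.pos]; simp [Real.rpow_neg_one]
  have hqinv : (q : ℝ)⁻¹ ≤ 1 / 2 := inv_le_of_inv_le₀ (by norm_num) (by linarith)
  have hyh : ‖y‖ ≤ 1 / 2 := by rw [hyn]; exact hqinv
  have hy35 : ‖y‖ ≤ 3 / 5 := by linarith
  have hw : ‖w‖ = 1 := by rw [hwdef, Complex.norm_natCast_cpow_of_pos hq.pos, betaJ_re_eq_zero, Real.rpow_zero]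
  have hvn : ‖v‖ ≤ 1 := χ.norm_le_one _
  have h2' : q = 2 → v ≠ 1 := by intro h; rw [hvdef, h]; simpa using h2 h
  -- coefficients
  set c : ℕ → ℂ := fun e => varpi2loc c' χ j (q ^ e) * nuConvChi χ (q ^ e) with hcdef
  set c0 : ℕ → ℂ := fun e => (∑ i ∈ Finset.range (e + 1), v ^ (e - i) *
      ((1 - (if Nat.Coprime q (q ^ (e - i)) then (1 : ℂ) else 0) * (v / ((q : ℂ) - 1))) /
        (1 - 1 * (v / ((q : ℂ) - 1))))) * nuConvChi χ (q ^ e) with hc0def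
  have hc : ∀ e, ‖c e‖ ≤ 2100 * ((e : ℝ) + 1) ^ 3 := fun e => norm_coeff_le c' χ j hq hF e
  have hc0 : ∀ e, ‖c0 e‖ ≤ 4 * ((e : ℝ) + 1) ^ 3 := by
    intro e
    rw [hc0def]; dsimp only
    rw [norm_mul]
    have hs : ‖∑ i ∈ Finset.range (e + 1), v ^ (e - i) *
        ((1 - (if Nat.Coprime q (q ^ (e - i)) then (1 : ℂ) else 0) * (v / ((q : ℂ) - 1))) /
          (1 - 1 * (v / ((q : ℂ) - 1))))‖ ≤ (e + 1) * 4 := by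
      calc _ ≤ ∑ i ∈ Finset.range (e + 1), ‖v ^ (e - i) *
            ((1 - (if Nat.Coprime q (q ^ (e - i)) then (1 : ℂ) else 0) * (v / ((q : ℂ) - 1))) /
              (1 - 1 * (v / ((q : ℂ) - 1))))‖ := norm_sum_le _ _
        _ ≤ ∑ i ∈ Finset.range (e + 1), (4 : ℝ) := Finset.sum_le_sum fun i _ => by
            rw [norm_mul, norm_pow]
            have h4 := (model_ratio_bounds (el := (if Nat.Coprime q (q ^ (e - i)) then (1 : ℂ) else 0)) hq hv h2'
              (by split_ifs <;> simp)).2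
            have hp : ‖v‖ ^ (e - i) ≤ 1 := pow_le_one₀ (norm_nonneg _) hvn
            calc ‖v‖ ^ (e - i) * ‖(1 - (if Nat.Coprime q (q ^ (e - i)) then (1 : ℂ) else 0) * (v / ((q : ℂ) - 1))) /
                  (1 - 1 * (v / ((q : ℂ) - 1)))‖ ≤ 1 * 4 := mul_le_mul hp h4 (norm_nonneg _) (by norm_num)
              _ = 4 := by norm_num
        _ = (e + 1) * 4 := by simp
    calc _ ≤ ((e + 1) * 4) * ((e : ℝ) + 1) ^ 2 := mul_le_mul hs (norm_nuConvChi_prime_pow_le χ hq e)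
          (norm_nonneg _) (by positivity)
      _ = 4 * ((e : ℝ) + 1) ^ 3 := by ring
  -- the series difference
  have hd : ∀ e, ‖c e - c0 e‖ ≤ 111400 * δ * ((e : ℝ) + 1) ^ 4 := by
    intro e
    have := norm_coeff_sub_model_le c' χ j hq hv h2 hF e
    rw [hcdef, hc0def]; dsimp only
    calc _ ≤ 111400 * ((e : ℝ) + 1) ^ 4 * δ := this
      _ = 111400 * δ * ((e : ℝ) + 1) ^ 4 := by ring
  have hd0 : c 0 - c0 0 = 0 := by
    obtain ⟨hM0, -⟩ := model_ratio_bounds (el := 1) hq hv h2' (by simp)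
    rw [hcdef, hc0def]; dsimp only
    rw [pow_zero, varpi2loc_one, nuConvChi_one, Finset.sum_range_one]
    simp only [Nat.sub_self, pow_zero, Nat.coprime_one_right_eq_true, if_true, one_mul, mul_one]
    rw [one_mul] at hM0
    rw [div_self hM0, sub_self]
  obtain ⟨hsd, hdle⟩ := norm_tsum_diff_le (K := 111400 * δ) (by positivity) hd hd0 hyh
  have hy1 : ‖y‖ < 1 := by linarith
  have hsc : Summable fun e : ℕ => c e * y ^ e :=
    (summable_norm_coeff_mul_pow' hc hy1).of_norm
  have hsc0 : Summable fun e : ℕ => c0 e * y ^ e := by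
    have := hsc.sub hsd
    refine this.congr fun e => ?_
    ring
  refine ⟨hsc0, ?_⟩
  have hCC : ‖∑' e : ℕ, c e * y ^ e - ∑' e : ℕ, c0 e * y ^ e‖ ≤ 12288 * (111400 * δ) * ‖y‖ := by
    rw [← hsc.tsum_sub hsc0]
    have : ∑' e : ℕ, (c e * y ^ e - c0 e * y ^ e) = ∑' e : ℕ, (c e - c0 e) * y ^ e :=
      tsum_congr fun e => by ring
    rw [this]; exact hdle
  -- sizes
  have hCn : ‖∑' e : ℕ, c0 e * y ^ e‖ ≤ 240 * 4 := norm_tsum_coeff_mul_pow_le' hc0 hy35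
  obtain ⟨hN, -⟩ := norm_normPoly_le hy35 hw hvn
  have hNN := norm_normPoly_sub_model_le hyh hw hvn
  -- combine `N C − N⁰ C⁰ = N (C − C⁰) + (N − N⁰) C⁰`
  set N : ℂ := (1 - y) ^ 2 * (1 - w * y) * (1 - v * y) * (1 - v * (w * y)) ^ 2 with hNdef
  set N0 : ℂ := (1 - y) ^ 2 * (1 - 1 * y) * (1 - v * y) * (1 - v * (1 * y)) ^ 2 with hN0def
  set C : ℂ := ∑' e : ℕ, c e * y ^ e with hCdef
  set C0 : ℂ := ∑' e : ℕ, c0 e * y ^ e with hC0def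
  show ‖N * C - N0 * C0‖ ≤ 25000000000 * δ / q
  rw [show N * C - N0 * C0 = N * (C - C0) + (N - N0) * C0 by ring]
  calc ‖N * (C - C0) + (N - N0) * C0‖ ≤ ‖N‖ * ‖C - C0‖ + ‖N - N0‖ * ‖C0‖ := by
        rw [← norm_mul, ← norm_mul]; exact norm_add_le _ _
    _ ≤ 17 * (12288 * (111400 * δ) * ‖y‖) + (25 * ‖w - 1‖ * ‖y‖) * (240 * 4) := by gcongr
    _ ≤ 25000000000 * δ / q := by
        rw [hyn]
        have hw1 : ‖w - 1‖ ≤ δ := by rw [hδ]; linarith [norm_nonneg ((q : ℂ) ^ (-beta1 c' D) - 1)]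
        have hqi : 0 ≤ (q : ℝ)⁻¹ := by positivity
        rw [div_eq_mul_inv]
        nlinarith [mul_nonneg hδ0 hqi, mul_le_mul_of_nonneg_right hw1 hqi]

end PhiModel

/-! ## §3. The model series in closed form -/

section Closed

variable {D : ℕ} (χ : DirichletCharacter ℂ D)

/-- **Generating function of `(ν∗χ)` at a prime**: for `‖z‖ < 1`,
`Σ_e (ν∗χ)(q^e) zᵉ = ((1−z)(1−χ(q)z)²)⁻¹` (two Cauchy products of geometric series:
`ν(qⁱ) = Σ_{t≤i} χ(q)^t`, `(ν∗χ)(q^e) = Σ_{i≤e} ν(qⁱ)χ(q)^{e−i}`). [cite: Zhang2022LandauSiegel, §16 (16.15) p.94] -/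
theorem tsum_nuConvChi_prime_pow_mul_pow {q : ℕ} (hq : q.Prime) {z : ℂ} (hz : ‖z‖ < 1) :
    (Summable fun e : ℕ => ‖nuConvChi χ (q ^ e) * z ^ e‖) ∧
      ∑' e : ℕ, nuConvChi χ (q ^ e) * z ^ e = ((1 - z) * (1 - χ (q : ZMod D) * z) ^ 2)⁻¹ := by
  set v : ℂ := χ (q : ZMod D) with hvdef
  have hv : ‖v‖ ≤ 1 := χ.norm_le_one _
  have hvz : ‖v * z‖ < 1 := by rw [norm_mul]; nlinarith [norm_nonneg v, norm_nonneg z]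
  -- geometric series
  have hG : HasSum (fun n : ℕ => z ^ n) (1 - z)⁻¹ := hasSum_geometric_of_norm_lt_one hz
  have hV : HasSum (fun n : ℕ => (v * z) ^ n) (1 - v * z)⁻¹ := hasSum_geometric_of_norm_lt_one hvz
  have hGn : Summable fun n : ℕ => ‖z ^ n‖ := by
    simp_rw [norm_pow]; exact summable_geometric_of_lt_one (norm_nonneg _) hz
  have hVn : Summable fun n : ℕ => ‖(v * z) ^ n‖ := by
    simp_rw [norm_pow]; exact summable_geometric_of_lt_one (norm_nonneg _) hvz
  -- first Cauchy product: `Σ ν(qⁿ) zⁿ = (1 − vz)⁻¹ (1 − z)⁻¹`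
  have hνcoef : ∀ n : ℕ, ∑ k ∈ Finset.range (n + 1), (v * z) ^ k * z ^ (n - k) = nu χ (q ^ n) * z ^ n := by
    intro n
    rw [nu, Literature.NumberTheory.LFunctions.divisorSumChar_prime_pow χ hq,
      Literature.NumberTheory.LFunctions.geomPartialSum, Finset.sum_mul]
    refine Finset.sum_congr rfl fun k hk => ?_
    have hk' : k ≤ n := Nat.lt_succ_iff.mp (Finset.mem_range.mp hk)
    rw [mul_pow, mul_assoc, ← pow_add, Nat.add_sub_cancel' hk']
  have hν : ∑' n : ℕ, nu χ (q ^ n) * z ^ n = (1 - v * z)⁻¹ * (1 - z)⁻¹ := by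
    rw [← hV.tsum_eq, ← hG.tsum_eq, tsum_mul_tsum_eq_tsum_sum_range_of_summable_norm hVn hGn]
    exact (tsum_congr hνcoef).symm
  have hνn : Summable fun n : ℕ => ‖nu χ (q ^ n) * z ^ n‖ := by
    have := summable_norm_sum_mul_range_of_summable_norm hVn hGn
    exact this.congr fun n => by rw [hνcoef]
  -- second Cauchy product
  have hacoef : ∀ n : ℕ, ∑ k ∈ Finset.range (n + 1), (nu χ (q ^ k) * z ^ k) * (v * z) ^ (n - k) =
      nuConvChi χ (q ^ n) * z ^ n := by
    intro n
    rw [nuConvChi_prime_pow χ hq, Finset.sum_mul]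
    refine Finset.sum_congr rfl fun k hk => ?_
    have hk' : k ≤ n := Nat.lt_succ_iff.mp (Finset.mem_range.mp hk)
    rw [mul_pow]
    calc nu χ (q ^ k) * z ^ k * (v ^ (n - k) * z ^ (n - k))
        = nu χ (q ^ k) * v ^ (n - k) * (z ^ k * z ^ (n - k)) := by ring
      _ = nu χ (q ^ k) * v ^ (n - k) * z ^ n := by rw [← pow_add, Nat.add_sub_cancel' hk']
  have hasum : Summable fun n : ℕ => ‖nuConvChi χ (q ^ n) * z ^ n‖ := by
    have := summable_norm_sum_mul_range_of_summable_norm hνn hVn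
    exact this.congr fun n => by rw [hacoef]
  refine ⟨hasum, ?_⟩
  have h := tsum_mul_tsum_eq_tsum_sum_range_of_summable_norm hνn hVn
  rw [hν, hV.tsum_eq, tsum_congr hacoef] at h
  rw [← h]
  have h1 : (1 : ℂ) - z ≠ 0 := by
    intro h0; have : ‖z‖ = 1 := by rw [show z = 1 from by linear_combination -h0]; simp
    linarith
  have h2 : (1 : ℂ) - v * z ≠ 0 := by
    intro h0; have : ‖v * z‖ = 1 := by rw [show v * z = 1 from by linear_combination -h0]; simp
    linarith
  field_simp

/-- For a prime `q` and `k ≥ 1`: `q` is not coprime to `q^k`; it is coprime to `q^0`. [folklore] -/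
private theorem coprime_prime_pow_iff {q : ℕ} (hq : q.Prime) (k : ℕ) : Nat.Coprime q (q ^ k) ↔ k = 0 := by
  constructor
  · intro h
    by_contra hk
    exact (Nat.Prime.coprime_iff_not_dvd hq).mp h (dvd_pow_self q hk)
  · rintro rfl; simp

/-- **The model sum** `Σ_{i≤e} v^{e−i}ρ⁰(q^{e−i}) = 1 + r·Σ_{b=1}^{e} v^b` with `r = (1 − v/(q−1))⁻¹`:
for `v = 1` it is `1 + e·r`, for `v = −1` it is `(1 − r/2) + (r/2)(−1)^e`. [cite: Zhang2022LandauSiegel, App. A p.106] -/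
theorem model_sum_eq {v : ℂ} {q : ℕ} (hq : q.Prime) (hden : 1 - 1 * (v / ((q : ℂ) - 1)) ≠ 0) (e : ℕ) :
    (v = 1 → ∑ i ∈ Finset.range (e + 1), v ^ (e - i) *
        ((1 - (if Nat.Coprime q (q ^ (e - i)) then (1 : ℂ) else 0) * (v / ((q : ℂ) - 1))) /
          (1 - 1 * (v / ((q : ℂ) - 1)))) = 1 + e * (1 - v / ((q : ℂ) - 1))⁻¹) ∧
    (v = -1 → ∑ i ∈ Finset.range (e + 1), v ^ (e - i) *
        ((1 - (if Nat.Coprime q (q ^ (e - i)) then (1 : ℂ) else 0) * (v / ((q : ℂ) - 1))) /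
          (1 - 1 * (v / ((q : ℂ) - 1)))) =
        (1 - (1 - v / ((q : ℂ) - 1))⁻¹ / 2) + ((1 - v / ((q : ℂ) - 1))⁻¹ / 2) * (-1) ^ e) := by
  set r : ℂ := (1 - v / ((q : ℂ) - 1))⁻¹ with hr
  rw [one_mul] at hden
  -- split off the last term (i = e) and simplify the others
  have hsplit : ∑ i ∈ Finset.range (e + 1), v ^ (e - i) *
      ((1 - (if Nat.Coprime q (q ^ (e - i)) then (1 : ℂ) else 0) * (v / ((q : ℂ) - 1))) /
        (1 - 1 * (v / ((q : ℂ) - 1)))) = 1 + r * ∑ i ∈ Finset.range e, v ^ (e - i) := by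
    rw [Finset.sum_range_succ, Nat.sub_self, pow_zero, pow_zero, if_pos (Nat.coprime_one_right q)]
    simp only [one_mul]
    rw [div_self hden, add_comm, Finset.mul_sum]
    congr 1
    refine Finset.sum_congr rfl fun i hi => ?_
    have hi' : i < e := Finset.mem_range.mp hi
    have hne : ¬ Nat.Coprime q (q ^ (e - i)) := by rw [coprime_prime_pow_iff hq]; omega
    rw [if_neg hne, zero_mul, sub_zero, hr, one_div]
    ring
  rw [hsplit]
  constructor
  · intro h1
    rw [h1]; simp; ring
  · intro hm
    rw [hm]
    -- `Σ_{i<e} (−1)^{e−i} = ((−1)^e − 1)/2`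
    have hgeo : ∑ i ∈ Finset.range e, (-1 : ℂ) ^ (e - i) = ((-1) ^ e - 1) / 2 := by
      have href := Finset.sum_range_reflect (fun j => (-1 : ℂ) ^ (j + 1)) e
      have hreindex : ∑ j ∈ Finset.range e, (-1 : ℂ) ^ (e - 1 - j + 1) = ∑ i ∈ Finset.range e, (-1 : ℂ) ^ (e - i) := by
        refine Finset.sum_congr rfl fun j hj => ?_
        have hj' : j < e := Finset.mem_range.mp hj
        congr 1; omega
      rw [← hreindex, href]
      have hg := geom_sum_eq (show (-1 : ℂ) ≠ 1 by norm_num) e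
      rw [show ∑ j ∈ Finset.range e, (-1 : ℂ) ^ (j + 1) = (-1) * ∑ j ∈ Finset.range e, (-1 : ℂ) ^ j by
        rw [Finset.mul_sum]; refine Finset.sum_congr rfl fun j _ => by ring, hg]
      ring
    rw [hgeo]
    ring

end Closed

/-! ## §4. `Φ⁰_q = (1 − q⁻²)/M_q` for `χ(q) = ±1` -/

section PhiClosed

variable {D : ℕ} (χ : DirichletCharacter ℂ D)

/-- `(ν∗χ)(q^e) = C(e+2,2)` when `χ(q) = 1`. [cite: Zhang2022LandauSiegel, §16 (16.15) p.94] -/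
theorem nuConvChi_prime_pow_of_apply_eq_one {q : ℕ} (hq : q.Prime) (h1 : χ (q : ZMod D) = 1) (e : ℕ) :
    nuConvChi χ (q ^ e) = ((e + 2).choose 2 : ℂ) := by
  rw [nuConvChi_prime_pow χ hq, Nat.cast_choose_two]
  have hν : ∀ i : ℕ, nu χ (q ^ i) = (i : ℂ) + 1 := fun i => by
    rw [nu, Literature.NumberTheory.LFunctions.divisorSumChar_prime_pow χ hq, h1,
      Literature.NumberTheory.LFunctions.geomPartialSum_one_left]
  simp_rw [hν, h1, one_pow, mul_one]
  have key : ∀ n : ℕ, (∑ i ∈ Finset.range n, ((i : ℂ) + 1)) * 2 = (n : ℂ) * ((n : ℂ) + 1) := by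
    intro n
    induction n with
    | zero => simp
    | succ n ih => rw [Finset.sum_range_succ, add_mul, ih]; push_cast; ring
  have h := key (e + 1)
  push_cast at h ⊢
  linear_combination h / 2

/-- **The model factor in closed form, `χ(q) = 1` (`q ≥ 3`)**: with `y = q^{−1}`, `r = (1 − 1/(q−1))⁻¹`,
`(1−y)⁶ · Σ_e (1 + e r)C(e+2,2) yᵉ = (1−y)³ + 3ry(1−y)² = (1 − y²)/M_q`, `M_q = (1 − 1/(q−1))/(1 − 1/q)`.
[cite: Zhang2022LandauSiegel, §16 Lemma 16.2 p.94, App. A p.106] -/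
theorem Phi_model_eq_of_apply_eq_one {q : ℕ} (hq : q.Prime) (h1 : χ (q : ZMod D) = 1) (hq3 : 3 ≤ q) :
    (1 - (q : ℂ) ^ (-(1 : ℂ))) ^ 2 * (1 - 1 * (q : ℂ) ^ (-(1 : ℂ))) * (1 - χ (q : ZMod D) * (q : ℂ) ^ (-(1 : ℂ))) *
            (1 - χ (q : ZMod D) * (1 * (q : ℂ) ^ (-(1 : ℂ)))) ^ 2 *
        (∑' e : ℕ, (∑ i ∈ Finset.range (e + 1), χ (q : ZMod D) ^ (e - i) *
          ((1 - (if Nat.Coprime q (q ^ (e - i)) then (1 : ℂ) else 0) * (χ (q : ZMod D) / ((q : ℂ) - 1))) /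
            (1 - 1 * (χ (q : ZMod D) / ((q : ℂ) - 1))))) * nuConvChi χ (q ^ e) * ((q : ℂ) ^ (-(1 : ℂ))) ^ e)
      = (1 - ((q : ℂ) ^ (-(1 : ℂ))) ^ 2) / locMain (χ (q : ZMod D)) q := by
  have hq3r : (3 : ℝ) ≤ q := by exact_mod_cast hq3
  have hqC : (q : ℂ) ≠ 0 := by exact_mod_cast hq.ne_zero
  set y : ℂ := (q : ℂ) ^ (-(1 : ℂ)) with hydef
  have hyq : y = (q : ℂ)⁻¹ := by rw [hydef, Complex.cpow_neg_one]
  have hyn : ‖y‖ < 1 := by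
    rw [hyq, norm_inv, Complex.norm_natCast]; exact inv_lt_one_of_one_lt₀ (by exact_mod_cast hq.one_lt)
  have hq1 : (q : ℂ) - 1 ≠ 0 := by
    intro h; have := congrArg Complex.re h; simp at this; linarith
  have hq2 : (q : ℂ) - 2 ≠ 0 := by
    intro h; have := congrArg Complex.re h; simp at this; linarith
  have hden : 1 - 1 * ((1 : ℂ) / ((q : ℂ) - 1)) ≠ 0 := by
    rw [one_mul, show (1 : ℂ) - 1 / ((q : ℂ) - 1) = ((q : ℂ) - 2) / ((q : ℂ) - 1) by field_simp; ring]
    exact div_ne_zero hq2 hq1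
  set r : ℂ := (1 - 1 / ((q : ℂ) - 1))⁻¹ with hr
  rw [h1]
  -- the model coefficients
  have hcoef : ∀ e : ℕ, (∑ i ∈ Finset.range (e + 1), (1 : ℂ) ^ (e - i) *
      ((1 - (if Nat.Coprime q (q ^ (e - i)) then (1 : ℂ) else 0) * (1 / ((q : ℂ) - 1))) /
        (1 - 1 * (1 / ((q : ℂ) - 1))))) * nuConvChi χ (q ^ e) * y ^ e =
      ((e + 2).choose 2 : ℂ) * y ^ e + 3 * r * (((e + 2).choose 3 : ℂ) * y ^ e) := by
    intro e
    rw [(model_sum_eq (v := (1 : ℂ)) hq hden e).1 rfl, nuConvChi_prime_pow_of_apply_eq_one χ hq h1, ← hr]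
    have h3 : ((e + 2).choose 3 : ℂ) * 3 = ((e + 2).choose 2 : ℂ) * e := by
      have := Nat.choose_succ_right_eq (e + 2) 2
      rw [show e + 2 - 2 = e by omega] at this
      exact_mod_cast this
    linear_combination (-(r * y ^ e)) * h3
  -- the two binomial series
  have S2 : HasSum (fun e : ℕ => ((e + 2).choose 2 : ℂ) * y ^ e) (1 / (1 - y) ^ 3) :=
    hasSum_choose_mul_geometric_of_norm_lt_one 2 hyn
  have S3' : HasSum (fun n : ℕ => ((n + 3).choose 3 : ℂ) * y ^ n * y) (1 / (1 - y) ^ 4 * y) :=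
    (hasSum_choose_mul_geometric_of_norm_lt_one 3 hyn).mul_right y
  have S3 : HasSum (fun e : ℕ => ((e + 2).choose 3 : ℂ) * y ^ e) (1 / (1 - y) ^ 4 * y) := by
    rw [← hasSum_nat_add_iff' 1]
    rw [Finset.sum_range_one, Nat.choose_eq_zero_of_lt (by norm_num : 0 + 2 < 3), Nat.cast_zero, zero_mul, sub_zero]
    refine S3'.congr_fun fun n => ?_
    rw [show n + 1 + 2 = n + 3 by ring, pow_succ, mul_assoc]
  have S : HasSum (fun e : ℕ => (∑ i ∈ Finset.range (e + 1), (1 : ℂ) ^ (e - i) *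
      ((1 - (if Nat.Coprime q (q ^ (e - i)) then (1 : ℂ) else 0) * (1 / ((q : ℂ) - 1))) /
        (1 - 1 * (1 / ((q : ℂ) - 1))))) * nuConvChi χ (q ^ e) * y ^ e)
      (1 / (1 - y) ^ 3 + 3 * r * (1 / (1 - y) ^ 4 * y)) :=
    (S2.add (S3.mul_left (3 * r))).congr_fun hcoef
  rw [S.tsum_eq]
  -- the rational identity
  have hy1 : (1 : ℂ) - y ≠ 0 := by
    intro h0; have : ‖y‖ = 1 := by rw [show y = 1 from by linear_combination -h0]; simp
    linarith
  have e1 : (1 : ℂ) - 1 / ((q : ℂ) - 1) = ((q : ℂ) - 2) / ((q : ℂ) - 1) := by field_simp; ring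
  have e2 : (1 : ℂ) - 1 / (q : ℂ) = ((q : ℂ) - 1) / q := by field_simp
  have e3 : (1 : ℂ) - (q : ℂ)⁻¹ = ((q : ℂ) - 1) / q := by field_simp
  unfold locMain
  rw [hr, hyq]
  simp only [one_mul]
  rw [e1, e2, e3]
  field_simp
  ring

/-- **The model factor in closed form, `χ(q) = −1`**: with `y = q^{−1}`, `r = (1 + 1/(q−1))⁻¹ = 1 − y`,
`(1−y)³(1+y)³ · [(1 − r/2)A(y) + (r/2)A(−y)] = (1−y²)(1 − y + ry) = (1 − y²)²  = (1−y²)/M_q`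
(`A(z) = Σ(ν∗χ)(q^e)zᵉ = ((1−z)(1+z)²)⁻¹`). [cite: Zhang2022LandauSiegel, §16 Lemma 16.2 p.94, App. A p.106] -/
theorem Phi_model_eq_of_apply_eq_neg_one {q : ℕ} (hq : q.Prime) (hm : χ (q : ZMod D) = -1) :
    (1 - (q : ℂ) ^ (-(1 : ℂ))) ^ 2 * (1 - 1 * (q : ℂ) ^ (-(1 : ℂ))) * (1 - χ (q : ZMod D) * (q : ℂ) ^ (-(1 : ℂ))) *
            (1 - χ (q : ZMod D) * (1 * (q : ℂ) ^ (-(1 : ℂ)))) ^ 2 *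
        (∑' e : ℕ, (∑ i ∈ Finset.range (e + 1), χ (q : ZMod D) ^ (e - i) *
          ((1 - (if Nat.Coprime q (q ^ (e - i)) then (1 : ℂ) else 0) * (χ (q : ZMod D) / ((q : ℂ) - 1))) /
            (1 - 1 * (χ (q : ZMod D) / ((q : ℂ) - 1))))) * nuConvChi χ (q ^ e) * ((q : ℂ) ^ (-(1 : ℂ))) ^ e)
      = (1 - ((q : ℂ) ^ (-(1 : ℂ))) ^ 2) / locMain (χ (q : ZMod D)) q := by
  have hq2r : (2 : ℝ) ≤ q := by exact_mod_cast hq.two_le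
  have hqC : (q : ℂ) ≠ 0 := by exact_mod_cast hq.ne_zero
  set y : ℂ := (q : ℂ) ^ (-(1 : ℂ)) with hydef
  have hyq : y = (q : ℂ)⁻¹ := by rw [hydef, Complex.cpow_neg_one]
  have hyn : ‖y‖ < 1 := by
    rw [hyq, norm_inv, Complex.norm_natCast]; exact inv_lt_one_of_one_lt₀ (by exact_mod_cast hq.one_lt)
  have hyn' : ‖-y‖ < 1 := by rw [norm_neg]; exact hyn
  have hq1 : (q : ℂ) - 1 ≠ 0 := by
    intro h; have := congrArg Complex.re h; simp at this; linarith
  have hden : 1 - 1 * ((-1 : ℂ) / ((q : ℂ) - 1)) ≠ 0 := by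
    rw [one_mul, show (1 : ℂ) - -1 / ((q : ℂ) - 1) = (q : ℂ) / ((q : ℂ) - 1) by field_simp; ring]
    exact div_ne_zero hqC hq1
  set r : ℂ := (1 - (-1 : ℂ) / ((q : ℂ) - 1))⁻¹ with hr
  -- the two evaluations of the generating function
  obtain ⟨hAs, hA⟩ := tsum_nuConvChi_prime_pow_mul_pow χ hq hyn
  obtain ⟨hAs', hA'⟩ := tsum_nuConvChi_prime_pow_mul_pow χ hq hyn'
  rw [hm] at hA hA' ⊢
  -- the model coefficients
  have hcoef : ∀ e : ℕ, (∑ i ∈ Finset.range (e + 1), (-1 : ℂ) ^ (e - i) *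
      ((1 - (if Nat.Coprime q (q ^ (e - i)) then (1 : ℂ) else 0) * ((-1 : ℂ) / ((q : ℂ) - 1))) /
        (1 - 1 * ((-1 : ℂ) / ((q : ℂ) - 1))))) * nuConvChi χ (q ^ e) * y ^ e =
      (1 - r / 2) * (nuConvChi χ (q ^ e) * y ^ e) + (r / 2) * (nuConvChi χ (q ^ e) * (-y) ^ e) := by
    intro e
    rw [(model_sum_eq (v := (-1 : ℂ)) hq hden e).2 rfl, ← hr, neg_pow y e]
    ring
  have S : HasSum (fun e : ℕ => (∑ i ∈ Finset.range (e + 1), (-1 : ℂ) ^ (e - i) *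
      ((1 - (if Nat.Coprime q (q ^ (e - i)) then (1 : ℂ) else 0) * ((-1 : ℂ) / ((q : ℂ) - 1))) /
        (1 - 1 * ((-1 : ℂ) / ((q : ℂ) - 1))))) * nuConvChi χ (q ^ e) * y ^ e)
      ((1 - r / 2) * ((1 - y) * (1 - (-1) * y) ^ 2)⁻¹ + (r / 2) * ((1 - -y) * (1 - (-1) * -y) ^ 2)⁻¹) := by
    have h1 := (hAs.of_norm.hasSum.mul_left (1 - r / 2))
    have h2 := (hAs'.of_norm.hasSum.mul_left (r / 2))
    rw [hA] at h1
    rw [hA'] at h2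
    exact (h1.add h2).congr_fun hcoef
  rw [S.tsum_eq]
  have hy1 : (1 : ℂ) - y ≠ 0 := by
    intro h0; have : ‖y‖ = 1 := by rw [show y = 1 from by linear_combination -h0]; simp
    linarith
  have hy2 : (1 : ℂ) + y ≠ 0 := by
    intro h0; have : ‖y‖ = 1 := by rw [show y = -1 from by linear_combination h0]; simp
    linarith
  have hq1' : (q : ℂ) + 1 ≠ 0 := by
    intro h; have := congrArg Complex.re h; simp at this; linarith
  have e1 : (1 : ℂ) - -1 / ((q : ℂ) - 1) = (q : ℂ) / ((q : ℂ) - 1) := by field_simp; ring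
  have e2 : (1 : ℂ) - -1 / (q : ℂ) = ((q : ℂ) + 1) / q := by field_simp; ring
  have e3 : (1 : ℂ) - (q : ℂ)⁻¹ = ((q : ℂ) - 1) / q := by field_simp
  have e4 : (1 : ℂ) + (q : ℂ)⁻¹ = ((q : ℂ) + 1) / q := by field_simp
  unfold locMain
  rw [hr, hyq]
  simp only [one_mul, neg_mul, mul_neg, neg_neg, sub_neg_eq_add]
  rw [e1, e2, e3, e4]
  field_simp
  ring

end PhiClosed

end Literature.NumberTheory.LFunctions.Zhang2022.Lemma162R

end
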